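import Summits.ResolutionOfSingularities.ResolutionOfSingularities.Theorems.FrobeniusClosingSteerMemberDimension
import Summits.ResolutionOfSingularities.ResolutionOfSingularities.Theorems.FrobeniusClosingSteerTailCodimBound
import Literature.AlgebraicGeometry.Resolution.BlowupDimension
import HarnessLib

/-!
# Crux `Steer` (stmt-ResolutionOfSingularities-16345), chain W4.1, R2 σ_top line at `p = 2`: **hit heights**
# (the height bookkeeping `HitHeightLtTwoN` (Θ2) of the §σ2.22 THREAD SPLIT, Theses-free body)

OURS (campaign `res-hironaka`, rung L ★L-G4, slot W4.1, chain W4.1; seat `res-type-071` on res-plan-2's IDLE POOL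
DEAL #2 2026-08-27T08:42:41Z «W4.1 U1», cut by `res-L0-w41-plan-1` UNCLAIMED-STUB LIST 08:41:57Z; replaces the role
of no printed item; NOT a statement of the manuscript under review; AI review is weaker than expert review).
SIBLING of `FrobeniusClosingSteerTailCodimBound.lean` (p502821) and `FrobeniusClosingSteerMemberDimension.lean`
(p503921). It serves the in-skeleton leaf `hitHeightLtTwoN_holds : HitHeightLtTwoN` of the skeleton of record
(`L/res-L0-w41-lead-1/Steer_r27.lean`, §σ2.22 = res-L0-w41-strat-2's r25-native delta 730cc186352ccba7 l.67):

* (a) **every positive-dimensional centre of a steered run has height `< n`** — it is a non-maximal prime of a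
  member `R j`, and `dim R j ≤ trdeg_k K = n` (`TailCodim.ringKrullDim_locAtCentre_le` over a finitely generated
  model, `SteeredExit.exists_model_of_tower`): `HitHeight.height_lt_of_tower`, `HitHeight.height_le_of_tower`;
* (b) **the dimension inequality between two members `R i ≤ R m` of the run** — for a prime `W` of `R m`,
  `ht W ≤ ht (W ∩ R i)`: both members are localisations at the centre of `O` of finitely generated models
  `A ≤ A' ⊆ O` of `K / k`, `A'` is of finite type and ALGEBRAIC over `A` (`K = Frac k[A₀, t]`, `t ^ p ∈ A₀ ≤ A`,
  `TailCodim.isAlgebraic_of_adjoin_isFractionRing`), heights are unchanged by localisation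
  (`IsLocalization.height_under`), and `ht (W ∩ A') ≤ ht (W ∩ A)` is Matsumura Thm. 15.5 with
  `tr.deg_A A' = 0` and the residue term dropped (tree `height_le_height_of_liesOver_of_finiteType_of_isAlgebraic`):
  `HitHeight.height_le_height_comap_of_models`, `HitHeight.height_le_height_comap_of_tower`;
* (c) **inclusions of members are local** (every member is dominated by `O`):
  `HitHeight.comap_maximalIdeal_of_locAtCentre`, `HitHeight.comap_maximalIdeal_of_tower`;
* (d) the assembled statement in the run's vocabulary, `HitHeight.hitHeight_of_steeredRun` — generic in the
  permissibility predicate `Perm` (consumed: `Perm S f P → P` prime and `P ≠ 𝔪_S`), with the run clause of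
  `IsSteeredRun` and the relations `IsPosStep` / `IsAncestorStep` / `IsHitStep` UNFOLDED verbatim: (a) for every
  positive step `ht P j ≤ d` (`n = d + 1`), and (b) if `i < m < j`, `i` is an ancestor of `j` and `m` HITS `j`
  (`P m ≤ W := (P j) ∩ R m`, `m` not an ancestor of `j`), then `m` is a positive step and `ht P m < ht P j`.
  Proof of (b): `W ∩ R i = P i ≠ 𝔪_i` so `W ≠ 𝔪_m` (local inclusion), hence `P m ≠ 𝔪_m`;
  `ht P m ≤ ht W ≤ ht P i = ht P j` by (b) above; equality would force `P m = W` (`Ideal.eq_of_le_of_height_le`)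
  and make `m` an ancestor of `j`.

No binder of the sketch's `CoreDatum` beyond `A₀.FG`, `t ^ p ∈ A₀`, `Frac (k[A₀, t]) = K` and `trdeg_k K = n` is used.
[cite: Matsumura1987, Thm. 15.5] [cite: NovacoskiSpivakovsky2014, Def. 2.8 and Lemma 2.9] [folklore]
-/

noncomputable section

-- `Summit.<S>.<S>.…` duplicates the summit name by design (single-problem summit).
set_option linter.dupNamespace false

open IsLocalRing

namespace Summit.ResolutionOfSingularities.ResolutionOfSingularities.Theorems.SwitchingDichotomy

open Literature.AlgebraicGeometry.Resolution

namespace HitHeight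

variable {k K : Type} [Field k] [Field K] [Algebra k K]

/-! ## (c) Domination: inclusions between localisations at the centre of `O` are local -/

omit [Algebra k K] in
/-- **Inclusions of local rings at the centre of `O` are local.** For `B, B' ⊆ O` and
`S = B_{𝔪_O ∩ B} ≤ S' = B'_{𝔪_O ∩ B'}` inside `K`, the maximal ideal of `S'` contracts to the maximal ideal of `S`:
both are the centres of `O` (the elements of value `< 1`, `mem_maximalIdeal_locAtCentre_iff`). OURS. [folklore] -/
theorem comap_maximalIdeal_of_locAtCentre {O : ValuationSubring K} {B B' S S' : Subring K}
    (hB : B ≤ O.toSubring) (hB' : B' ≤ O.toSubring) (hS : locAtCentre B O = S)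
    (hS' : locAtCentre B' O = S') [IsLocalRing S] [IsLocalRing S'] (hle : S ≤ S') :
    (maximalIdeal S').comap (Subring.inclusion hle) = maximalIdeal S := by
  subst hS hS'
  ext x
  rw [Ideal.mem_comap, mem_maximalIdeal_locAtCentre_iff hB', mem_maximalIdeal_locAtCentre_iff hB]
  exact Iff.rfl

omit [Algebra k K] in
/-- **Members of a tower of local blowings up are localisations at the centre**: if `R 0 = B_{𝔪_O ∩ B}` (`B ⊆ O`)
and the first `N` steps are local blowings up with respect to `O`, then `R N = C_{𝔪_O ∩ C}` for a subring
`B ≤ C ⊆ O` (`C = B[t]`, Novacoski–Spivakovsky Lemma 2.9; tree `SteeredExit.isLocalBlowup_of_tower`).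
[cite: NovacoskiSpivakovsky2014, Lemma 2.9] -/
theorem exists_locAtCentre_eq_of_tower (O : ValuationSubring K) {B : Subring K} (hB : B ≤ O.toSubring)
    {R : ℕ → Subring K} (hR0 : R 0 = locAtCentre B O) {N : ℕ}
    (hstep : ∀ i < N, IsLocalBlowup O (R i) (R (i + 1))) :
    ∃ C : Subring K, B ≤ C ∧ C ≤ O.toSubring ∧ locAtCentre C O = R N := by
  obtain ⟨-, t, ht, h⟩ := SteeredExit.isLocalBlowup_of_tower O hB hR0 hstep
  have hB' : (B : Set K) ⊆ O := hB
  exact ⟨_, fun x hx => Subring.subset_closure (Or.inl hx),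
    Subring.closure_le.mpr (Set.union_subset hB' ht), h.symm⟩

omit [Algebra k K] in
/-- **Inclusions between members of a tower of local blowings up are local**: for members `R i ≤ R m` of a tower
starting at `B_{𝔪_O ∩ B}` (`B ⊆ O`), `𝔪_{R m} ∩ R i = 𝔪_{R i}` (every member is dominated by `O`). OURS.
[cite: NovacoskiSpivakovsky2014, Def. 2.8 and Lemma 2.9] -/
theorem comap_maximalIdeal_of_tower (O : ValuationSubring K) {B : Subring K} (hB : B ≤ O.toSubring)
    {R : ℕ → Subring K} (hR0 : R 0 = locAtCentre B O) {i m : ℕ}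
    (hsti : ∀ l < i, IsLocalBlowup O (R l) (R (l + 1))) (hstm : ∀ l < m, IsLocalBlowup O (R l) (R (l + 1)))
    [IsLocalRing (R i)] [IsLocalRing (R m)] (hle : R i ≤ R m) :
    (maximalIdeal (R m)).comap (Subring.inclusion hle) = maximalIdeal (R i) := by
  obtain ⟨C, -, hC, hRi⟩ := exists_locAtCentre_eq_of_tower O hB hR0 hsti
  obtain ⟨C', -, hC', hRm⟩ := exists_locAtCentre_eq_of_tower O hB hR0 hstm
  exact comap_maximalIdeal_of_locAtCentre hC hC' hRi hRm hle

/-! ## (b) The dimension inequality between two localisations at the centre of finitely generated models -/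

/-- **`ht W ≤ ht (W ∩ S)` for `S = A_{𝔪_O ∩ A} ≤ S' = A'_{𝔪_O ∩ A'}`**, `A ≤ A' ⊆ O` finitely generated
`k`-subalgebras of `K` with `K` algebraic over `A`, and `W` a prime of `S'`: heights are unchanged by localisation at a
prime (`ht W = ht (W ∩ A')`, `ht (W ∩ S) = ht (W ∩ A)`), and `ht (W ∩ A') ≤ ht (W ∩ A)` is the dimension inequality
(Matsumura Thm. 15.5) for the finite-type algebraic extension of Noetherian domains `A ⊆ A'` with the residue term
dropped (tree `height_le_height_of_liesOver_of_finiteType_of_isAlgebraic`). OURS. [cite: Matsumura1987, Thm. 15.5] -/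
theorem height_le_height_comap_of_models (O : ValuationSubring K) (A A' : Subalgebra k K) (hAA' : A ≤ A')
    (h' : A'.toSubring ≤ O.toSubring) (hfgA : A.FG) (hfgA' : A'.FG) (halg : Algebra.IsAlgebraic A K)
    {S S' : Subring K} (hS : locAtCentre A.toSubring O = S) (hS' : locAtCentre A'.toSubring O = S')
    (hle : S ≤ S') (W : Ideal S') [W.IsPrime] :
    W.height ≤ (W.comap (Subring.inclusion hle)).height := by
  classical
  subst hS hS'
  have h : A.toSubring ≤ O.toSubring := fun x hx => h' (hAA' hx)
  have hAA's : A.toSubring ≤ A'.toSubring := fun x hx => hAA' hx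
  haveI := isLocalization_locAtCentre h
  haveI := isLocalization_locAtCentre h'
  -- ### the finite-type algebraic extension of Noetherian domains `A ⊆ A'`
  letI : Algebra k A.toSubring := A.algebra
  letI : Algebra k A'.toSubring := A'.algebra
  letI : Algebra A.toSubring A'.toSubring := (Subring.inclusion hAA's).toAlgebra
  haveI : IsScalarTower k A.toSubring A'.toSubring :=
    IsScalarTower.of_algebraMap_eq fun x => Subtype.ext rfl
  haveI : Algebra.FiniteType k A.toSubring := A.fg_iff_finiteType.mp hfgA
  haveI : Algebra.FiniteType k A'.toSubring := A'.fg_iff_finiteType.mp hfgA'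
  haveI : Algebra.FiniteType A.toSubring A'.toSubring :=
    Algebra.FiniteType.of_restrictScalars_finiteType k A.toSubring A'.toSubring
  haveI : IsNoetherianRing A.toSubring := Algebra.FiniteType.isNoetherianRing k A.toSubring
  haveI : FaithfulSMul A.toSubring A'.toSubring :=
    (faithfulSMul_iff_algebraMap_injective A.toSubring A'.toSubring).mpr
      (Subring.inclusion_injective hAA's)
  haveI : Algebra.IsAlgebraic A.toSubring K := halg
  haveI : Algebra.IsAlgebraic A.toSubring A'.toSubring :=
    Algebra.IsAlgebraic.of_injective
      ({ toRingHom := A'.toSubring.subtype, commutes' := fun _ => rfl } : A'.toSubring →ₐ[A.toSubring] K)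
      Subtype.val_injective
  -- ### contract `W` to `A'` and `W ∩ S` to `A`; the first contraction lies over the second
  haveI : ((W.comap (Subring.inclusion hle)).comap
      (algebraMap A.toSubring (locAtCentre A.toSubring O))).IsPrime := Ideal.comap_isPrime _ _
  haveI : (W.comap (algebraMap A'.toSubring (locAtCentre A'.toSubring O))).LiesOver
      ((W.comap (Subring.inclusion hle)).comap (algebraMap A.toSubring (locAtCentre A.toSubring O))) := by
    refine ⟨?_⟩
    rw [Ideal.under_def, Ideal.comap_comap, Ideal.comap_comap]
    rfl
  -- ### heights: localisation does not change them, Matsumura 15.5 compares them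
  calc W.height = (W.comap (algebraMap A'.toSubring (locAtCentre A'.toSubring O))).height :=
      (IsLocalization.height_under (subringCentre A'.toSubring O h').primeCompl W).symm
    _ ≤ ((W.comap (Subring.inclusion hle)).comap
          (algebraMap A.toSubring (locAtCentre A.toSubring O))).height :=
      height_le_height_of_liesOver_of_finiteType_of_isAlgebraic _ _
    _ = (W.comap (Subring.inclusion hle)).height :=
      IsLocalization.height_under (subringCentre A.toSubring O h).primeCompl _

/-- **The dimension inequality between two members of a steered run.** For fields `k ⊆ K`, a valuation ring `O`
of `K`, a finitely generated `k`-subalgebra `A₀ ⊆ O`, `t ∈ K` with `t ^ p ∈ A₀` (`p ≥ 1`) and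
`Frac (k[A₀, t]) = K`, and a sequence `R : ℕ → Subring K` with `R 0 = (A₀)_{𝔪_O ∩ A₀}` whose first `m` steps are
local blowings up with respect to `O` (Novacoski–Spivakovsky Def. 2.8): for `i ≤ m` with `R i ≤ R m` and a prime
`W` of `R m`, **`ht W ≤ ht (W ∩ R i)`** — `R i` and `R m` are the local rings at the centre of finitely generated
models `A₀ ≤ A ≤ A' ⊆ O` (`SteeredExit.exists_model_of_tower`, applied to the tower and to its tail from `i`), and
`K` is algebraic over `A` (`TailCodim.isAlgebraic_of_adjoin_isFractionRing`). OURS.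
[cite: Matsumura1987, Thm. 15.5] [cite: NovacoskiSpivakovsky2014, Def. 2.8 and Lemma 2.9] -/
theorem height_le_height_comap_of_tower (O : ValuationSubring K) (A₀ : Subalgebra k K)
    (h₀ : A₀.toSubring ≤ O.toSubring) (hfg : A₀.FG) {t : K} {p : ℕ} (hp : 0 < p) (htp : t ^ p ∈ A₀)
    (hfr : IsFractionRing (Algebra.adjoin k (insert t (A₀ : Set K))) K)
    {R : ℕ → Subring K} (hR0 : R 0 = locAtCentre A₀.toSubring O) {i m : ℕ} (him : i ≤ m)
    (hst : ∀ l < m, IsLocalBlowup O (R l) (R (l + 1))) (hle : R i ≤ R m) (W : Ideal (R m)) [W.IsPrime] :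
    W.height ≤ (W.comap (Subring.inclusion hle)).height := by
  -- a model `A` of `R i`, then a model `A' ≥ A` of `R m` along the tail of the tower from `i`
  obtain ⟨A, hA, h0A, hfgA, hRi⟩ := SteeredExit.exists_model_of_tower O A₀ h₀ hfg hR0 (N := i)
    (fun l hl => hst l (lt_of_lt_of_le hl him))
  obtain ⟨A', hA', hAA', hfgA', hRm⟩ := SteeredExit.exists_model_of_tower O A hA hfgA
    (R := fun l => R (i + l)) hRi.symm (N := m - i) (fun l hl => hst (i + l) (by omega))
  have him' : i + (m - i) = m := Nat.add_sub_cancel' him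
  simp only [him'] at hRm
  exact height_le_height_comap_of_models O A A' hAA' hA' hfgA hfgA'
    (TailCodim.isAlgebraic_of_adjoin_isFractionRing A₀ A h0A hp htp hfr) hRi hRm hle W

/-! ## (a) Heights of non-maximal primes of a member -/

/-- **A non-maximal prime of a member has height `< n`.** Under `A₀ ⊆ O` finitely generated and `trdeg_k K = n`,
every member `R N` of a tower of local blowings up of `(A₀)_{𝔪_O ∩ A₀}` with respect to `O` is the local ring at the
centre of a finitely generated model, of Krull dimension `≤ n` (`TailCodim.ringKrullDim_locAtCentre_le`); so a prime
`P ≠ 𝔪` of `R N` has `ht P < ht 𝔪 = dim R N ≤ n`. OURS. [cite: Matsumura1987, Thm. 5.6]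
[cite: NovacoskiSpivakovsky2014, Def. 2.8 and Lemma 2.9] -/
theorem height_lt_of_tower (O : ValuationSubring K) (A₀ : Subalgebra k K) (h₀ : A₀.toSubring ≤ O.toSubring)
    (hfg : A₀.FG) {n : ℕ} (htr : Algebra.trdeg k K = n) {R : ℕ → Subring K}
    (hR0 : R 0 = locAtCentre A₀.toSubring O) {N : ℕ} (hst : ∀ l < N, IsLocalBlowup O (R l) (R (l + 1)))
    [IsLocalRing (R N)] (P : Ideal (R N)) [P.IsPrime] (hP : P ≠ maximalIdeal (R N)) :
    P.height < n := by
  obtain ⟨A₁, h₁, -, hfg₁, hRA⟩ := SteeredExit.exists_model_of_tower O A₀ h₀ hfg hR0 hst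
  have hdimR : ringKrullDim (R N) ≤ n := by
    rw [← hRA]
    exact TailCodim.ringKrullDim_locAtCentre_le O A₁ h₁ hfg₁ htr
  have hmax : ((maximalIdeal (R N)).height : WithBot ℕ∞) ≤ n := by
    rw [IsLocalRing.maximalIdeal_height_eq_ringKrullDim]
    exact hdimR
  have hmax' : (maximalIdeal (R N)).height ≤ n := by exact_mod_cast hmax
  haveI : (maximalIdeal (R N)).FiniteHeight :=
    Ideal.finiteHeight_iff_lt.mpr (Or.inr (lt_of_le_of_lt hmax' (ENat.coe_lt_top n)))
  have hlt : P < maximalIdeal (R N) := lt_of_le_of_ne (IsLocalRing.le_maximalIdeal (Ideal.IsPrime.ne_top ‹_›)) hP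
  exact lt_of_lt_of_le (Ideal.height_strict_mono_of_isPrime_of_isPrime hlt) hmax'

/-- The `ℕ`-predecessor form of `height_lt_of_tower`: with `trdeg_k K = d + 1`, a prime `P ≠ 𝔪` of a member has
`ht P ≤ d` (for the skeleton: `n = 4`, centres of a steered run have height `≤ 3`). OURS. [folklore] -/
theorem height_le_of_tower (O : ValuationSubring K) (A₀ : Subalgebra k K) (h₀ : A₀.toSubring ≤ O.toSubring)
    (hfg : A₀.FG) {d : ℕ} (htr : Algebra.trdeg k K = (d + 1 : ℕ)) {R : ℕ → Subring K}
    (hR0 : R 0 = locAtCentre A₀.toSubring O) {N : ℕ} (hst : ∀ l < N, IsLocalBlowup O (R l) (R (l + 1)))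
    [IsLocalRing (R N)] (P : Ideal (R N)) [P.IsPrime] (hP : P ≠ maximalIdeal (R N)) :
    P.height ≤ d := by
  have h := height_lt_of_tower O A₀ h₀ hfg htr hR0 hst P hP
  have hne : P.height ≠ ⊤ := ne_top_of_lt h
  obtain ⟨c, hc⟩ := ENat.ne_top_iff_exists.mp hne
  rw [← hc] at h ⊢
  have hcd : c < d + 1 := by exact_mod_cast h
  exact_mod_cast Nat.lt_succ_iff.mp hcd

/-! ## (d) The assembled statement along a steered run (run clause and step relations unfolded) -/

omit [Algebra k K] in
/-- Along the run, a centre is a prime ideal; a centre other than the maximal ideal is a `Perm`-centre. [folklore] -/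
theorem isPrime_centre (Perm : ∀ S : Subring K, IsLocalRing S → S → Ideal S → Prop) {p : ℕ}
    (hPerm : ∀ (S : Subring K) (hS : IsLocalRing S) (f : S) (P : Ideal S),
      Perm S hS f P → P.IsPrime ∧ P ≠ @maximalIdeal S _ hS)
    {S : Subring K} (hL : IsLocalRing S) (f : S) (P : Ideal S)
    (hC : Perm S hL f P ∨ (P = maximalIdeal S ∧ (∀ Q : Ideal S, ¬ Perm S hL f Q) ∧
      ∃ g : S, f - g ^ p ∈ maximalIdeal S ^ p)) : P.IsPrime := by
  rcases hC with hperm | ⟨hPm, -, -⟩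
  · exact (hPerm _ hL _ _ hperm).1
  · rw [hPm]; exact Ideal.IsMaximal.isPrime' _

/-- **`HitHeightLtTwoN`, Theses-free body.** Along a σ_top-steered run of the datum `(A₀, t)` (`A₀ ⊆ O` finitely
generated, `t ^ p ∈ A₀`, `p ≥ 1`, `Frac (k[A₀, t]) = K`, `trdeg_k K = d + 1`), generic in the permissibility
predicate `Perm` (consumed: a permissible centre is a prime other than the maximal ideal), with the run clause of the
sketch's `IsSteeredRun` unfolded (second conjunct) and `IsPosStep` / `IsAncestorStep` / `IsHitStep` unfolded:
(a) every positive-dimensional centre `P j ≠ 𝔪_j` has `ht P j ≤ d`;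
(b) if `i < m`, `i` is an ANCESTOR of `j` (`i < j`, both positive, `ht P j = ht P i`, `P j ∩ R i = P i`) and `m` HITS
`j` (`m < j`, `m` not an ancestor of `j`, `P m ≤ W := P j ∩ R m`), then `m` is a positive step and `ht P m < ht P j`:
`W ∩ R i = P i ≠ 𝔪_i` and local inclusions give `W ≠ 𝔪_m ⊇`-wise `P m ≠ 𝔪_m`; `ht P m ≤ ht W ≤ ht P i = ht P j`
(`Ideal.height_mono`, `height_le_height_comap_of_tower`); equality forces `P m = W` (`Ideal.eq_of_le_of_height_le`),
i.e. `m` an ancestor of `j`. OURS. [cite: Matsumura1987, Thm. 15.5] [cite: NovacoskiSpivakovsky2014, Def. 2.8, 2.11,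
Lemma 2.9] [folklore] -/
theorem hitHeight_of_steeredRun
    (Perm : ∀ S : Subring K, IsLocalRing S → S → Ideal S → Prop) (p : ℕ)
    (hPerm : ∀ (S : Subring K) (hS : IsLocalRing S) (f : S) (P : Ideal S),
      Perm S hS f P → P.IsPrime ∧ P ≠ @maximalIdeal S _ hS)
    (O : ValuationSubring K) (A₀ : Subalgebra k K) (h₀ : A₀.toSubring ≤ O.toSubring) (hfg : A₀.FG)
    (hp : 0 < p) {t : K} (htp : t ^ p ∈ A₀)
    (hfr : IsFractionRing (Algebra.adjoin k (insert t (A₀ : Set K))) K)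
    {d : ℕ} (htr : Algebra.trdeg k K = (d + 1 : ℕ))
    (R : ℕ → Subring K) (P : (i : ℕ) → Ideal (R i)) (s : ℕ → K)
    (hR0 : R 0 = locAtCentre A₀.toSubring O)
    (hrun : ∀ i, ∃ (hL : IsLocalRing (R i)) (hs : s i ^ p ∈ R i),
      (Perm (R i) hL ⟨s i ^ p, hs⟩ (P i) ∨
        (P i = maximalIdeal (R i) ∧ (∀ Q : Ideal (R i), ¬ Perm (R i) hL ⟨s i ^ p, hs⟩ Q) ∧
          ∃ g : R i, (⟨s i ^ p, hs⟩ : R i) - g ^ p ∈ maximalIdeal (R i) ^ p)) ∧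
      IsLocalBlowupAlong O (R i) (P i) (R (i + 1)) ∧
      ∃ x g : K, ((∃ hx : x ∈ R i, (⟨x, hx⟩ : R i) ∈ P i) ∧ x ≠ 0 ∧
        ∀ y : R i, y ∈ P i → O.valuation (y : K) ≤ O.valuation x) ∧ g ∈ R i ∧
        s i = x * s (i + 1) + g) :
    (∀ j, (∃ _ : IsLocalRing (R j), P j ≠ maximalIdeal (R j)) → (P j).height ≤ d) ∧
    (∀ i m j : ℕ,
      (i < j ∧ (∃ _ : IsLocalRing (R i), P i ≠ maximalIdeal (R i)) ∧
        (∃ _ : IsLocalRing (R j), P j ≠ maximalIdeal (R j)) ∧ (P j).height = (P i).height ∧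
        ∃ h : R i ≤ R j, Ideal.comap (Subring.inclusion h) (P j) = P i) →
      i < m →
      (m < j ∧
        ¬ (m < j ∧ (∃ _ : IsLocalRing (R m), P m ≠ maximalIdeal (R m)) ∧
            (∃ _ : IsLocalRing (R j), P j ≠ maximalIdeal (R j)) ∧ (P j).height = (P m).height ∧
            ∃ h : R m ≤ R j, Ideal.comap (Subring.inclusion h) (P j) = P m) ∧
        ∃ h : R m ≤ R j, P m ≤ Ideal.comap (Subring.inclusion h) (P j)) →
      (∃ _ : IsLocalRing (R m), P m ≠ maximalIdeal (R m)) ∧ (P m).height < (P j).height) := by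
  classical
  have hst : ∀ N, ∀ l < N, IsLocalBlowup O (R l) (R (l + 1)) := fun N l _ => (hrun l).2.2.2.1.isLocalBlowup
  have hprime : ∀ l, (P l).IsPrime := fun l => by
    obtain ⟨hL, hs, hC, -, -⟩ := hrun l
    exact isPrime_centre (p := p) Perm hPerm hL ⟨s l ^ p, hs⟩ (P l) hC
  refine ⟨fun j ⟨hL, hne⟩ => ?_, fun i m j hanc him hhit => ?_⟩
  · -- ### (a)
    haveI := hL
    haveI := hprime j
    exact height_le_of_tower O A₀ h₀ hfg htr hR0 (hst j) (P j) hne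
  · -- ### (b)
    obtain ⟨hij, ⟨hLi, hPi⟩, ⟨hLj, hPj⟩, hhtij, hRij, hcij⟩ := hanc
    obtain ⟨hmj, hnanc, hRmj, hPmW⟩ := hhit
    obtain ⟨hLm, -, -, -, -⟩ := hrun m
    haveI := hLi; haveI := hLj; haveI := hLm
    haveI := hprime i; haveI := hprime j; haveI := hprime m
    -- `R` is increasing along local blowings up
    have hmono : Monotone R := monotone_nat_of_le_succ fun l => (hst (l + 1) l (Nat.lt_succ_self l)).le
    have hRim : R i ≤ R m := hmono him.le
    -- `W := P j ∩ R m`, a prime of `R m` containing `P m`, contracting to `P i`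
    set W : Ideal (R m) := Ideal.comap (Subring.inclusion hRmj) (P j) with hW
    haveI hWp : W.IsPrime := Ideal.comap_isPrime _ _
    have hWi : W.comap (Subring.inclusion hRim) = P i := by
      rw [hW, Ideal.comap_comap]
      exact hcij
    -- ### `W ≠ 𝔪_m`: its contraction to `R i` is `P i ≠ 𝔪_i` (local inclusion)
    have hWne : W ≠ maximalIdeal (R m) := by
      intro hWm
      apply hPi
      rw [← hWi, hWm]
      exact comap_maximalIdeal_of_tower O h₀ hR0 (hst i) (hst m) hRim
    -- ### `P m ≠ 𝔪_m`
    have hPm : P m ≠ maximalIdeal (R m) := by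
      intro hPmax
      apply hWne
      have hmax : (P m).IsMaximal := hPmax ▸ IsLocalRing.maximalIdeal.isMaximal (R m)
      exact (hmax.eq_of_le hWp.ne_top hPmW).symm.trans hPmax
    refine ⟨⟨hLm, hPm⟩, ?_⟩
    -- ### `ht P m ≤ ht W ≤ ht P i = ht P j`
    have hWle : W.height ≤ (P j).height := by
      rw [hhtij, ← hWi]
      exact height_le_height_comap_of_tower O A₀ h₀ hfg hp htp hfr hR0 him.le (hst m) hRim W
    have hPmle : (P m).height ≤ (P j).height := (Ideal.height_mono hPmW).trans hWle
    refine lt_of_le_of_ne hPmle fun heq => hnanc ?_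
    -- ### equality forces `P m = W`, i.e. `m` is an ancestor of `j`
    haveI : (P m).FiniteHeight :=
      Ideal.finiteHeight_iff_lt.mpr (Or.inr (lt_of_le_of_lt
        (hPmle.trans (height_le_of_tower O A₀ h₀ hfg htr hR0 (hst j) (P j) hPj))
        (ENat.coe_lt_top d)))
    have hPW : P m = W := Ideal.eq_of_le_of_height_le (P m) hPmW (hWle.trans heq.symm.le)
    exact ⟨hmj, ⟨hLm, hPm⟩, ⟨hLj, hPj⟩, heq.symm, hRmj, hPW.symm⟩

end HitHeight

end Summit.ResolutionOfSingularities.ResolutionOfSingularities.Theorems.SwitchingDichotomy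

end
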